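import Summits.BirchSwinnertonDyer.BirchSwinnertonDyer.Theorems.RamifiedSevenEllipticUnitsStrictControlEulerChar
import Summits.BirchSwinnertonDyer.BirchSwinnertonDyer.Theorems.RamifiedSevenEllipticUnitsStrictControlExactControl
import HarnessLib

set_option linter.dupNamespace false
set_option autoImplicit false

/-!
# Route `RamifiedSevenEllipticUnits` (rung K7r), crux `StrictTorsionSeven` (stmt-BirchSwinnertonDyer-19144):
# (R-tors)@7 REDUCED to bottom-layer control — no Euler system, no `Λ`-module left

Cell `bsd-cm`, seat `bsd-cm-k7r-c3` (D-0074, g0). HONEST FRAMING: nothing here closes the crux; BSD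
is not proved by any of this; the item closes a rung leaf only when its own signature is proved.

## What is proved

The typed crux (R-tors) `O11.RamifiedCMStrictTorsionAt W p` asks, at every O11 frame `(K, 𝔭, W', C)`
of `(W, p)` with `r_an(W) = 1` and every anticyclotomic `ℤ_p`-extension `κ` with topological
generator `γ`, that the REAL `Λ`-module `X = AcSelmer.XAc (W_K) p κ 𝔭 ∅ γ` (Pontryagin dual of
Castella's strict-at-`𝔭` Selmer group `Sel_𝔭(K^ac_∞, E[p^∞])`) be `Λ`-torsion with a principal
characteristic ideal `(f)`, `f(0) ≠ 0` (`∃ n₀, HasCharValuationAt … n₀`), and that `X[T]` be finite.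
The birth skeleton attributed the torsion clause to the elliptic-unit Euler system
(Burungale–Kobayashi–Nakamura–Ota 2026, Prop. 3.7 (2), PREPRINT). In analytic rank one NONE of that is
needed: by Greenberg's criterion on the dual pair (sibling cell's `X11b/AnticyclotomicEulerChar`,
`X11b/AnticyclotomicTorsionCriterion`, wired to the Literature objects by seat k7r-c4's
`RamifiedSevenEllipticUnitsStrictControlEulerChar`), both clauses follow from the FINITENESS of the
`γ`-invariants `Sel^γ = H⁰(Γ, Sel_𝔭(K^ac_∞, E[p^∞]))`; and by k7r-c4's exact control
(`RamifiedSevenEllipticUnitsStrictControlExactControl`: Greenberg's Lemmas 3.1–3.3 + strict descent at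
`𝔭`, for any `ℤ_p`-extension of a totally complex field) that finiteness is EQUIVALENT to the
finiteness of Castella's Selmer group over `K`, `Sel_𝔭(K, E[p^∞])` (`X11b.AcSelmer.selmerAcBase`),
granted two LOCAL no-`p`-torsion statements. Hence:

* `ramifiedCMStrictTorsionAt_of_finite_invariants` / `strictTorsionSeven_of_finite_invariants`:
  (R-tors)@`p` at `W` (resp. the route item `StrictTorsionSeven`) from "`Sel^γ` finite at every frame";
* `ramifiedCMStrictTorsionAt_of_noPTorsion_of_finite_base` /
  **`strictTorsionSeven_of_noPTorsion_of_finite_base`**: (R-tors)@`p` at `W` (resp.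
  `StrictTorsionSeven`) from, at every frame `(K, 𝔭, W', C)` of analytic rank one,
  (A𝔭) `W(K_𝔭)[p] = 0`, (Av) at every finite `v ∤ p`: good reduction or `W(K_v)[p] = 0`, and
  (F) `Sel_𝔭(K, W[p^∞])` finite.

So crux #3 of the route has EXACTLY the residual inputs of crux #4 (k7r-c4, STATUS 02:45Z): (A𝔭) =
BKNO (3.16) read at the bottom, (Av) = memo (LV1)–(LV3), and (F) ⟸ the `K → ℚ` twist descent
`Sel_𝔭(K, E[p^∞]) ≅ Sel_str(W/ℚ)[p^∞] ⊕ Sel_str(W'/ℚ)[p^∞]` with both summands finite in rank one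
(Greenberg–Wiles / GZK: `StrictSha.strictSelmerIndexAt_holds` + `Finite W.sha`). Nothing is asserted;
no named fact is minted; the three inputs are displayed hypotheses.

References: [GreenbergLNM1716] §1 pp. 60–61 (Thm. 1.4 and the torsion criterion), §3 Lemmas 3.1–3.3,
§4 Lemma 4.2; [Castella2018] Def. 2.2, Thm. 2.3 (arXiv:1704.06608 p. 5);
[BurungaleKobayashiNakamuraOta2026] Prop. 3.7 (2), (3.16) (arXiv:2608.06879; shape only — the
attribution this file makes unnecessary in rank one).
-/

noncomputable section

open scoped Classical

open WeierstrassCurve NumberField IsDedekindDomain Field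
  Literature.NumberTheory.EllipticCurves
  Literature.NumberTheory.EllipticCurves.Rank1Residual
  Literature.NumberTheory.GaloisRepresentations
  Summit.BirchSwinnertonDyer.Rank1Residual
  Summit.BirchSwinnertonDyer.Rank1Residual.X11b
  Summit.BirchSwinnertonDyer.Rank1Residual.X11b.AcSelmer

namespace Summit.BirchSwinnertonDyer.BirchSwinnertonDyer.Theorems.RamifiedSevenEllipticUnits

/-! ## §1 (R-tors) at `(W, p)` from finiteness of the invariants / from the three bottom-layer inputs -/

section Curve

variable (W : WeierstrassCurve ℚ) [W.IsElliptic] (p : ℕ) [Fact p.Prime]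

/-- **(R-tors)@`p` at `W` from "`Sel^γ` finite at every frame".** If at every O11 frame
`(K, 𝔭, W', C)` of `(W, p)` with `r_an(W) = 1`, every anticyclotomic `κ` and topological generator
`γ`, the `γ`-invariants `H⁰(Γ, Sel_𝔭(K_∞, W[p^∞]))` are finite, then `O11.RamifiedCMStrictTorsionAt W p`
(Greenberg's criterion + Lemma 4.2 on the dual pair: k7r-c4's
`exists_hasCharValuationAt_and_finite_of_finite`). [cite: GreenbergLNM1716, §1 p. 61 and §4 Lemma 4.2 (p. 102)] -/
theorem ramifiedCMStrictTorsionAt_of_finite_invariants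
    (h : ∀ (K : Type) [Field K] [NumberField K] (𝔭 : HeightOneSpectrum (𝓞 K))
      (W' : WeierstrassCurve ℚ) [W'.IsElliptic] [W'.IsGloballyMinimal] (C : VariableChange ℚ),
      X12.O11.IsFrame W p K 𝔭 W' C → W.analyticRank = 1 →
      ∀ (κ : ZpExtension K p), κ.IsAnticyclotomic →
        ∀ (γ : absoluteGaloisGroup K) [Fact (κ.IsTopGenerator γ)],
          Finite (IwasawaDual.endInvariants
            (Castella2018.AcSelmer.conjSelmerAc (W.baseChange K) p κ 𝔭 ∅ γ - 1))) :
    X12.O11.RamifiedCMStrictTorsionAt W p := by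
  intro K _ _ 𝔭 W' _ _ C hF hr κ hκ γ _
  haveI : (W.baseChange K).IsElliptic := by rw [baseChange]; infer_instance
  obtain ⟨n₀, hn₀, hfinT⟩ :=
    exists_hasCharValuationAt_and_finite_of_finite (W.baseChange K) p κ 𝔭 γ
      (h K 𝔭 W' C hF hr κ hκ γ)
  exact ⟨⟨n₀, hn₀⟩, hfinT⟩

/-- **(R-tors)@`p` at `W` from the three bottom-layer inputs.** At every frame of analytic rank one
assume (A𝔭) `W(K_𝔭)[p] = 0`, (Av) good reduction or `W(K_v)[p] = 0` at every finite `v ∤ p`, and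
(F) `Sel_𝔭(K, W[p^∞])` (`selmerAcBase (W.baseChange K) p 𝔭 ∅`) finite. Then
`O11.RamifiedCMStrictTorsionAt W p`: exact control (k7r-c4's
`finite_endInvariants_iff_finite_selmerAcBase_of_noPTorsion`; the frame's `K` is imaginary
quadratic, hence totally complex) turns (F) into the finiteness of `H⁰(Γ, Sel_𝔭(K_∞, W[p^∞]))`, and
`ramifiedCMStrictTorsionAt_of_finite_invariants` concludes.
[cite: GreenbergLNM1716, §3 Lemmas 3.1–3.3 and §1 p. 61] [cite: BurungaleKobayashiNakamuraOta2026, (3.16) (arXiv:2608.06879; shape only)] -/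
theorem ramifiedCMStrictTorsionAt_of_noPTorsion_of_finite_base
    (h𝔭 : ∀ (K : Type) [Field K] [NumberField K] (𝔭 : HeightOneSpectrum (𝓞 K))
      (W' : WeierstrassCurve ℚ) [W'.IsElliptic] [W'.IsGloballyMinimal] (C : VariableChange ℚ),
      X12.O11.IsFrame W p K 𝔭 W' C →
      ∀ R : ((W.baseChange K).baseChange (𝔭.adicCompletion K)).toAffine.Point, p • R = 0 → R = 0)
    (hv : ∀ (K : Type) [Field K] [NumberField K] (𝔭 : HeightOneSpectrum (𝓞 K))
      (W' : WeierstrassCurve ℚ) [W'.IsElliptic] [W'.IsGloballyMinimal] (C : VariableChange ℚ),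
      X12.O11.IsFrame W p K 𝔭 W' C →
      ∀ v : HeightOneSpectrum (𝓞 K), ((p : ℕ) : 𝓞 K) ∉ v.asIdeal →
        (W.baseChange K).HasGoodReductionAt v ∨
          ∀ R : ((W.baseChange K).baseChange (v.adicCompletion K)).toAffine.Point,
            p • R = 0 → R = 0)
    (hfin : ∀ (K : Type) [Field K] [NumberField K] (𝔭 : HeightOneSpectrum (𝓞 K))
      (W' : WeierstrassCurve ℚ) [W'.IsElliptic] [W'.IsGloballyMinimal] (C : VariableChange ℚ),
      X12.O11.IsFrame W p K 𝔭 W' C → W.analyticRank = 1 →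
      Finite (selmerAcBase (W.baseChange K) p 𝔭 ∅)) :
    X12.O11.RamifiedCMStrictTorsionAt W p := by
  refine ramifiedCMStrictTorsionAt_of_finite_invariants W p fun K _ _ 𝔭 W' _ _ C hF hr κ _ γ _ ↦ ?_
  haveI : IsTotallyComplex K := hF.2.2.2.1.2
  haveI : (W.baseChange K).IsElliptic := by rw [baseChange]; infer_instance
  exact (finite_endInvariants_iff_finite_selmerAcBase_of_noPTorsion (W.baseChange K) p κ 𝔭 γ
    (h𝔭 K 𝔭 W' C hF) (hv K 𝔭 W' C hF)).mpr (hfin K 𝔭 W' C hF hr)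

end Curve

/-! ## §2 The route item on 𝒞₇ -/

section Seven

/-- **`StrictTorsionSeven` from "`Sel^γ` finite at every frame of every `W ∈ 𝒞₇`"**: the route item
stmt-BirchSwinnertonDyer-19144 REDUCES to a control statement at the bottom layer; the Euler system
of elliptic units is not needed for it in analytic rank one. [cite: GreenbergLNM1716, §1 p. 61 (proof of Thm 1.4)] -/
theorem strictTorsionSeven_of_finite_invariants
    (h : ∀ (W : WeierstrassCurve ℚ) [W.IsElliptic] [W.IsGloballyMinimal] [Fact (Nat.Prime 7)],
      X12.ClassCSeven W →
      ∀ (K : Type) [Field K] [NumberField K] (𝔭 : HeightOneSpectrum (𝓞 K))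
        (W' : WeierstrassCurve ℚ) [W'.IsElliptic] [W'.IsGloballyMinimal] (C : VariableChange ℚ),
        X12.O11.IsFrame W 7 K 𝔭 W' C → W.analyticRank = 1 →
        ∀ (κ : ZpExtension K 7), κ.IsAnticyclotomic →
          ∀ (γ : absoluteGaloisGroup K) [Fact (κ.IsTopGenerator γ)],
            Finite (IwasawaDual.endInvariants
              (Castella2018.AcSelmer.conjSelmerAc (W.baseChange K) 7 κ 𝔭 ∅ γ - 1))) :
    Summit.BirchSwinnertonDyer.BirchSwinnertonDyer.Theses.RamifiedSevenEllipticUnits.StrictTorsionSeven := by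
  intro W _ _ _ hC
  exact ramifiedCMStrictTorsionAt_of_finite_invariants W 7 (h W hC)

/-- **`StrictTorsionSeven` from the three bottom-layer inputs on 𝒞₇** — at every O11 frame
`(K, 𝔭, W', C)` of a `W ∈ 𝒞₇` at `7`: (A𝔭) `W(K_𝔭)[7] = 0` (`K_𝔭 = ℚ₇(√−7)`; BKNO (3.16) at the
bottom), (Av) good reduction or `W(K_v)[7] = 0` at every finite `v ∤ 7` (additive reduction at the
bad `v`, `7 ≥ 5`), (F) `Sel_𝔭(K, W[7^∞])` finite in analytic rank one (twist descent to
`Sel_str(W/ℚ)[7^∞] ⊕ Sel_str(W'/ℚ)[7^∞]`, finite by Greenberg–Wiles + GZK). These are the SAME residual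
inputs as crux #4 `StrictControlSeven` (k7r-c4). [cite: GreenbergLNM1716, §3 Lemmas 3.1–3.3, §1 p. 61] [cite: BurungaleKobayashiNakamuraOta2026, (3.16) (arXiv:2608.06879; shape only)] -/
theorem strictTorsionSeven_of_noPTorsion_of_finite_base
    (h𝔭 : ∀ (W : WeierstrassCurve ℚ) [W.IsElliptic] [W.IsGloballyMinimal] [Fact (Nat.Prime 7)],
      X12.ClassCSeven W →
      ∀ (K : Type) [Field K] [NumberField K] (𝔭 : HeightOneSpectrum (𝓞 K))
        (W' : WeierstrassCurve ℚ) [W'.IsElliptic] [W'.IsGloballyMinimal] (C : VariableChange ℚ),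
        X12.O11.IsFrame W 7 K 𝔭 W' C →
        ∀ R : ((W.baseChange K).baseChange (𝔭.adicCompletion K)).toAffine.Point, 7 • R = 0 → R = 0)
    (hv : ∀ (W : WeierstrassCurve ℚ) [W.IsElliptic] [W.IsGloballyMinimal] [Fact (Nat.Prime 7)],
      X12.ClassCSeven W →
      ∀ (K : Type) [Field K] [NumberField K] (𝔭 : HeightOneSpectrum (𝓞 K))
        (W' : WeierstrassCurve ℚ) [W'.IsElliptic] [W'.IsGloballyMinimal] (C : VariableChange ℚ),
        X12.O11.IsFrame W 7 K 𝔭 W' C →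
        ∀ v : HeightOneSpectrum (𝓞 K), ((7 : ℕ) : 𝓞 K) ∉ v.asIdeal →
          (W.baseChange K).HasGoodReductionAt v ∨
            ∀ R : ((W.baseChange K).baseChange (v.adicCompletion K)).toAffine.Point,
              7 • R = 0 → R = 0)
    (hfin : ∀ (W : WeierstrassCurve ℚ) [W.IsElliptic] [W.IsGloballyMinimal] [Fact (Nat.Prime 7)],
      X12.ClassCSeven W →
      ∀ (K : Type) [Field K] [NumberField K] (𝔭 : HeightOneSpectrum (𝓞 K))
        (W' : WeierstrassCurve ℚ) [W'.IsElliptic] [W'.IsGloballyMinimal] (C : VariableChange ℚ),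
        X12.O11.IsFrame W 7 K 𝔭 W' C → W.analyticRank = 1 →
        Finite (selmerAcBase (W.baseChange K) 7 𝔭 ∅)) :
    Summit.BirchSwinnertonDyer.BirchSwinnertonDyer.Theses.RamifiedSevenEllipticUnits.StrictTorsionSeven := by
  intro W _ _ _ hC
  exact ramifiedCMStrictTorsionAt_of_noPTorsion_of_finite_base W 7 (h𝔭 W hC) (hv W hC) (hfin W hC)

end Seven

end Summit.BirchSwinnertonDyer.BirchSwinnertonDyer.Theorems.RamifiedSevenEllipticUnits

end
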